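import Literature.Analysis.Convolution.DixmierMalliavinDecay
import Literature.Analysis.Convolution.DixmierMalliavinKernel
import Literature.Analysis.Convolution.DixmierMalliavinFactorization
import Mathlib.MeasureTheory.Measure.Haar.NormedSpace
import HarnessLib

/-!
# The Dixmier–Malliavin kernel package on `ℝ` with PRESCRIBED SUPPORT, and the factorization identity for smooth
# functions with bounded derivatives (Dixmier–Malliavin 1978, §2 Lemme 2.5–2.8, read for one-parameter subgroups)

Topic `Analysis/Convolution`; namespace `Literature.Analysis.Convolution.DixmierMalliavin` (the tree's, ★
`DixmierMalliavinKernel`).  THEOREMS ONLY (no definition, no named fact, no instance, no `sorry`).  Cell `hodgecm-mathlib`,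
F0∕P3, road «DM∞» (archimedean Dixmier–Malliavin, weak form, for `U(H)(L⁺ ⊗ ℝ)`), brick B1.

THE PRINT.  [DixmierMalliavin1978] §2 builds, for every sequence of positive numbers, `f, g ∈ C_c^∞(ℝ)` and scalars
`α_n` such that `Σ_n α_n f^{(n)} → δ − g` — with `f, g` supported in an arbitrary neighbourhood of `0` — and §3 applies this
ON A LIE GROUP along each one-parameter subgroup `t ↦ x·exp(tX)` to the functions `u(t) = φ(x·exp(tX))`, which are smooth with
bounded derivatives but NOT compactly supported.  The tree's ★ kernel package
`DixmierMalliavin.exists_kernel_package_of_annulusBound` (+ ★ `exists_annulus_bound_half`) gives `(b, f, h)` for every growth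
sequence `M`, with the convergence `Σ_{j<n} (−1)^j b_j f^{(2j)} ∗ φ → φ + h ∗ φ` tested on `φ ∈ C_c^∞(ℝ)` and no statement on the
supports.  This file supplies the two forms the Lie-group step consumes:

* §1 `exists_kernel_package` — the package, unconditionally (assembly of the two ★ theorems);
* §2 `exists_kernel_package_tsupport_subset` — the package with `tsupport f, tsupport h ⊆ [−δ, δ]` for any `δ > 0`: RESCALING
  `f_c(z) = c⁻¹ f(z/c)`, `h_c(z) = c⁻¹ h(z/c)`, `b^c_j = c^{2j} b_j` (`0 < c ≤ 1`) preserves the identity (`(f_c)^{(2j)}(z) =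
  c^{−2j−1} f^{(2j)}(z/c)`, the substitution `z = cy`) and the growth condition (`b^c_j ≤ b_j`), and shrinks the supports by `c`;
* §3 `eq_integral_sub_integral_of_bounded_iteratedDeriv` — THE IDENTITY FOR SMOOTH `u : ℝ → ℂ` WITH BOUNDED DERIVATIVES: if
  `‖u^{(m)}‖_∞ ≤ K_m` and `Σ_j b_j K_{2j} < ∞` then, for every `x`,
  `u(x) = ∫ f(y) U(x − y) dy − ∫ h(y) u(x − y) dy`, `U := Σ_j (−1)^j b_j u^{(2j)}` (cut `u` off to a `C_c^∞` function equal to `u`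
  near `x − (supp f ∪ supp h)`, move the derivatives onto `u` by ★ `integral_iteratedDeriv_mul_eq`, dominated convergence).

HONEST SCOPE.  One-variable real analysis over the tree's ℝ-case engine; nothing about groups here.  Consumer: brick B4 (one
Dixmier–Malliavin step along `t ↦ M·exp(tX)` in a real Banach algebra).  HC_CM is proved only modulo the printed citations until
rung 0 closes; this file discharges no printed statement of the programme.

## References
* J. Dixmier, P. Malliavin, *Factorisations de fonctions et de vecteurs indéfiniment différentiables*, Bull. Sci. Math. (2) **102**
  (1978) 305–330, §2 Lemme 2.5–2.8, §3 Théorème 3.1. [DixmierMalliavin1978]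
* M. V. Hegde, *The Dixmier–Malliavin theorem* (2021), §3.2–3.3. [Hegde2021]
-/

noncomputable section

open MeasureTheory Filter Set Function
open scoped ContDiff Topology

namespace Literature.Analysis.Convolution

namespace DixmierMalliavin

/-! ## §1 The kernel package, unconditionally -/

/-- **The Dixmier–Malliavin kernel package on `ℝ`** (assembly of ★ `exists_annulus_bound_half` and ★
`exists_kernel_package_of_annulusBound`): for every growth sequence `M` there are `b_j ≥ 0` with `b_j M_j ≤ 1` (`j ≥ 1`) and
`f, h ∈ C_c^∞(ℝ)` with `Σ_{j<n} (−1)^j b_j f^{(2j)} ∗ φ → φ + h ∗ φ` pointwise for every `φ ∈ C_c^∞(ℝ)`.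
[cite: DixmierMalliavin1978, §2 Lemme 2.5–2.8] [cite: Hegde2021, §3.2 Lemma 14] -/
theorem exists_kernel_package (M : ℕ → ℝ) :
    ∃ (b : ℕ → ℝ) (f h : ℝ → ℂ),
      (∀ j, 0 ≤ b j) ∧ (∀ j, 1 ≤ j → b j * M j ≤ 1) ∧ ContDiff ℝ ∞ f ∧ HasCompactSupport f ∧
      ContDiff ℝ ∞ h ∧ HasCompactSupport h ∧
      ∀ φ : ℝ → ℂ, ContDiff ℝ ∞ φ → HasCompactSupport φ → ∀ x : ℝ,
        Tendsto (fun n => ∫ y, (∑ j ∈ Finset.range n,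
            (-1 : ℂ) ^ j * b j * iteratedDeriv (2 * j) f y) * φ (x - y))
          atTop (𝓝 (φ x + ∫ y, h y * φ (x - y))) := by
  obtain ⟨K, hK⟩ := exists_annulus_bound_half
  exact exists_kernel_package_of_annulusBound K hK M

/-! ## §2 Rescaling: prescribed support -/

section Rescale

variable {f : ℝ → ℂ} {c : ℝ}

/-- Derivatives of the rescaled kernel: `(z ↦ c⁻¹ f(c⁻¹ z))^{(m)}(z) = c⁻¹ (c⁻¹)^m f^{(m)}(c⁻¹ z)`. [folklore] -/
private theorem iteratedDeriv_rescale (hf : ContDiff ℝ ∞ f) (c : ℝ) (m : ℕ) (z : ℝ) :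
    iteratedDeriv m (fun z => (c⁻¹ : ℝ) • f (c⁻¹ * z)) z = (c⁻¹ : ℝ) • ((c⁻¹) ^ m • iteratedDeriv m f (c⁻¹ * z)) := by
  have h1 : ContDiff ℝ ∞ (fun z => f (c⁻¹ * z)) := hf.comp (contDiff_const.mul contDiff_id)
  have h2 : iteratedDeriv m (fun z => (c⁻¹ : ℝ) • f (c⁻¹ * z)) z = (c⁻¹ : ℝ) • iteratedDeriv m (fun z => f (c⁻¹ * z)) z := by
    rw [show (fun z => (c⁻¹ : ℝ) • f (c⁻¹ * z)) = (c⁻¹ : ℝ) • (fun z => f (c⁻¹ * z)) from rfl]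
    exact iteratedDeriv_const_smul ((h1.of_le (mod_cast le_top)).contDiffAt) _
  rw [h2, iteratedDeriv_comp_const_smul (n := m) (hf.of_le (mod_cast le_top)) c⁻¹]

/-- Support of the rescaled kernel: if `tsupport f ⊆ [−R, R]` and `0 < c` then `z ↦ c⁻¹ f(c⁻¹ z)` vanishes off `[−cR, cR]`. [folklore] -/
private theorem rescale_eq_zero_of_not_mem {R : ℝ} (hR : tsupport f ⊆ Icc (-R) R) (hc : 0 < c) {z : ℝ} (hz : z ∉ Icc (-(c * R)) (c * R)) :
    (c⁻¹ : ℝ) • f (c⁻¹ * z) = 0 := by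
  have hz' : c⁻¹ * z ∉ Icc (-R) R := by
    intro h
    apply hz
    rw [mem_Icc] at h ⊢
    constructor
    · have := mul_le_mul_of_nonneg_left h.1 hc.le
      rw [← mul_assoc, mul_inv_cancel₀ hc.ne', one_mul, mul_neg] at this
      exact this
    · have := mul_le_mul_of_nonneg_left h.2 hc.le
      rw [← mul_assoc, mul_inv_cancel₀ hc.ne', one_mul] at this
      exact this
  have : f (c⁻¹ * z) = 0 := image_eq_zero_of_notMem_tsupport (fun h => hz' (hR h))
  rw [this, smul_zero]


/-- The rescaled partial kernels: `Σ_{j<n} (−1)^j (c^{2j} b_j) (f_c)^{(2j)}(z) = c⁻¹ Σ_{j<n} (−1)^j b_j f^{(2j)}(c⁻¹ z)` for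
`f_c(z) = c⁻¹ f(c⁻¹ z)`. [cite: DixmierMalliavin1978, §2 Lemme 2.5–2.8] -/
theorem sum_rescale (hf : ContDiff ℝ ∞ f) (hc : 0 < c) (b : ℕ → ℝ) (n : ℕ) (z : ℝ) :
    ∑ j ∈ Finset.range n, (-1 : ℂ) ^ j * ((c ^ (2 * j) * b j : ℝ) : ℂ) *
        iteratedDeriv (2 * j) (fun z => (c⁻¹ : ℝ) • f (c⁻¹ * z)) z =
      (c⁻¹ : ℝ) • ∑ j ∈ Finset.range n, (-1 : ℂ) ^ j * (b j : ℂ) * iteratedDeriv (2 * j) f (c⁻¹ * z) := by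
  rw [Finset.smul_sum]
  refine Finset.sum_congr rfl fun j _ => ?_
  rw [iteratedDeriv_rescale hf c (2 * j) z]
  have hcc : (c : ℂ) ≠ 0 := Complex.ofReal_ne_zero.mpr hc.ne'
  simp only [Complex.real_smul, Complex.ofReal_mul, Complex.ofReal_pow, Complex.ofReal_inv]
  have hpow : (c : ℂ) ^ (2 * j) * ((c : ℂ)⁻¹) ^ (2 * j) = 1 := by
    rw [← mul_pow, mul_inv_cancel₀ hcc, one_pow]
  linear_combination ((-1 : ℂ) ^ j * (b j : ℂ) * ((c : ℂ)⁻¹ * iteratedDeriv (2 * j) f (c⁻¹ * z))) * hpow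

/-- The substitution `z = c y` behind the rescaled identity:
`∫ (c⁻¹ G(c⁻¹ z)) ψ(x − z) dz = ∫ G(y) ψ(x − c y) dy` (`0 < c`). [folklore] -/
private theorem integral_rescale_mul (G ψ : ℝ → ℂ) (hc : 0 < c) (x : ℝ) :
    ∫ z, ((c⁻¹ : ℝ) • G (c⁻¹ * z)) * ψ (x - z) = ∫ y, G y * ψ (x - c * y) := by
  have h1 : (fun z => ((c⁻¹ : ℝ) • G (c⁻¹ * z)) * ψ (x - z)) =
      fun z => (c⁻¹ : ℝ) • ((fun y => G y * ψ (x - c * y)) (c⁻¹ * z)) := by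
    funext z
    simp only [smul_mul_assoc]
    congr 2
    rw [← mul_assoc, mul_inv_cancel₀ hc.ne', one_mul]
  rw [h1, integral_smul, MeasureTheory.Measure.integral_comp_inv_mul_left (fun y => G y * ψ (x - c * y)) c,
    abs_of_pos hc, smul_smul, inv_mul_cancel₀ hc.ne', one_smul]

end Rescale

/-- A common support radius for two compactly supported functions. [folklore] -/
private theorem exists_radius {f h : ℝ → ℂ} (hfc : HasCompactSupport f) (hhc : HasCompactSupport h) :
    ∃ R : ℝ, 0 < R ∧ (∀ y ∈ tsupport f, |y| ≤ R) ∧ (∀ y ∈ tsupport h, |y| ≤ R) := by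
  obtain ⟨r₁, hr₁⟩ := (hfc.isCompact.isBounded).subset_closedBall (0 : ℝ)
  obtain ⟨r₂, hr₂⟩ := (hhc.isCompact.isBounded).subset_closedBall (0 : ℝ)
  refine ⟨max 1 (max r₁ r₂), lt_of_lt_of_le one_pos (le_max_left _ _), fun y hy => ?_, fun y hy => ?_⟩
  · have := hr₁ hy
    rw [Metric.mem_closedBall, dist_zero_right, Real.norm_eq_abs] at this
    exact this.trans ((le_max_left _ _).trans (le_max_right _ _))
  · have := hr₂ hy
    rw [Metric.mem_closedBall, dist_zero_right, Real.norm_eq_abs] at this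
    exact this.trans ((le_max_right _ _).trans (le_max_right _ _))


/-- **The kernel package with prescribed support.**  For every `δ > 0` and every growth sequence `M` there are `b_j ≥ 0` with
`b_j M_j ≤ 1` (`j ≥ 1`) and `f, h ∈ C_c^∞(ℝ)` SUPPORTED IN `[−δ, δ]` with `Σ_{j<n} (−1)^j b_j f^{(2j)} ∗ φ → φ + h ∗ φ` pointwise
for every `φ ∈ C_c^∞(ℝ)` («f, g à support dans un voisinage arbitraire de 0»).
[cite: DixmierMalliavin1978, §2 Lemme 2.5–2.8 and §3 proof of Thm. 3.1] [cite: Hegde2021, §3.2 Lemma 14] -/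
theorem exists_kernel_package_tsupport_subset {δ : ℝ} (hδ : 0 < δ) (M : ℕ → ℝ) :
    ∃ (b : ℕ → ℝ) (f h : ℝ → ℂ),
      (∀ j, 0 ≤ b j) ∧ (∀ j, 1 ≤ j → b j * M j ≤ 1) ∧
      ContDiff ℝ ∞ f ∧ HasCompactSupport f ∧ tsupport f ⊆ Icc (-δ) δ ∧
      ContDiff ℝ ∞ h ∧ HasCompactSupport h ∧ tsupport h ⊆ Icc (-δ) δ ∧
      ∀ φ : ℝ → ℂ, ContDiff ℝ ∞ φ → HasCompactSupport φ → ∀ x : ℝ,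
        Tendsto (fun n => ∫ y, (∑ j ∈ Finset.range n,
            (-1 : ℂ) ^ j * b j * iteratedDeriv (2 * j) f y) * φ (x - y))
          atTop (𝓝 (φ x + ∫ y, h y * φ (x - y))) := by
  obtain ⟨b, f, h, hb0, hbM, hf, hfc, hh, hhc, hlim⟩ := exists_kernel_package M
  -- a common support radius
  obtain ⟨R, hRpos, hfR', hhR'⟩ := exists_radius hfc hhc
  have hfR : tsupport f ⊆ Icc (-R) R := fun z hz => by rw [mem_Icc, ← abs_le]; exact hfR' z hz
  have hhR : tsupport h ⊆ Icc (-R) R := fun z hz => by rw [mem_Icc, ← abs_le]; exact hhR' z hz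
  -- the scale `c = min 1 (δ / R)`
  set c : ℝ := min 1 (δ / R) with hc_def
  have hcpos : 0 < c := lt_min one_pos (div_pos hδ hRpos)
  have hc1 : c ≤ 1 := min_le_left _ _
  have hcR : c * R ≤ δ := by
    calc c * R ≤ (δ / R) * R := mul_le_mul_of_nonneg_right (min_le_right _ _) hRpos.le
      _ = δ := div_mul_cancel₀ δ hRpos.ne'
  have hIcc : Icc (-(c * R)) (c * R) ⊆ Icc (-δ) δ := Icc_subset_Icc (by linarith) hcR
  -- the rescaled package
  set f' : ℝ → ℂ := fun z => (c⁻¹ : ℝ) • f (c⁻¹ * z) with hf'_def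
  set h' : ℝ → ℂ := fun z => (c⁻¹ : ℝ) • h (c⁻¹ * z) with hh'_def
  set b' : ℕ → ℝ := fun j => c ^ (2 * j) * b j with hb'_def
  have hf's : ContDiff ℝ ∞ f' := (hf.comp (contDiff_const.mul contDiff_id)).const_smul _
  have hh's : ContDiff ℝ ∞ h' := (hh.comp (contDiff_const.mul contDiff_id)).const_smul _
  have hf'0 : ∀ z, z ∉ Icc (-δ) δ → f' z = 0 := fun z hz =>
    rescale_eq_zero_of_not_mem hfR hcpos (fun h => hz (hIcc h))
  have hh'0 : ∀ z, z ∉ Icc (-δ) δ → h' z = 0 := fun z hz =>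
    rescale_eq_zero_of_not_mem hhR hcpos (fun h => hz (hIcc h))
  have hf'c : HasCompactSupport f' := HasCompactSupport.intro isCompact_Icc hf'0
  have hh'c : HasCompactSupport h' := HasCompactSupport.intro isCompact_Icc hh'0
  have hf't : tsupport f' ⊆ Icc (-δ) δ :=
    closure_minimal (fun z hz => by by_contra hz'; exact hz (hf'0 z hz')) isClosed_Icc
  have hh't : tsupport h' ⊆ Icc (-δ) δ :=
    closure_minimal (fun z hz => by by_contra hz'; exact hz (hh'0 z hz')) isClosed_Icc
  refine ⟨b', f', h', fun j => mul_nonneg (pow_nonneg hcpos.le _) (hb0 j), fun j hj => ?_, hf's, hf'c, hf't, hh's, hh'c, hh't,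
    fun φ hφ hφc x => ?_⟩
  · -- `b'_j M_j ≤ 1`
    have hcpow : c ^ (2 * j) ≤ 1 := pow_le_one₀ hcpos.le hc1
    by_cases hM : 0 ≤ M j
    · calc b' j * M j = c ^ (2 * j) * (b j * M j) := by rw [hb'_def]; ring
        _ ≤ 1 * (b j * M j) := mul_le_mul_of_nonneg_right hcpow (mul_nonneg (hb0 j) hM)
        _ = b j * M j := one_mul _
        _ ≤ 1 := hbM j hj
    · have : b' j * M j ≤ 0 := mul_nonpos_of_nonneg_of_nonpos (mul_nonneg (pow_nonneg hcpos.le _) (hb0 j)) (le_of_not_ge hM)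
      linarith
  · -- the rescaled identity, from the original one tested on `t ↦ φ (c t)` at `x / c`
    have hφ' : ContDiff ℝ ∞ (fun t => φ (c * t)) := hφ.comp (contDiff_const.mul contDiff_id)
    have hφ'c : HasCompactSupport (fun t => φ (c * t)) :=
      hφc.comp_homeomorph (Homeomorph.mulLeft₀ c hcpos.ne')
    have key := hlim (fun t => φ (c * t)) hφ' hφ'c (x / c)
    have hxc : c * (x / c) = x := mul_div_cancel₀ x hcpos.ne'
    have e1 : ∀ n : ℕ, (∫ z, (∑ j ∈ Finset.range n, (-1 : ℂ) ^ j * (b' j : ℂ) * iteratedDeriv (2 * j) f' z) * φ (x - z)) =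
        ∫ y, (∑ j ∈ Finset.range n, (-1 : ℂ) ^ j * (b j : ℂ) * iteratedDeriv (2 * j) f y) * φ (c * (x / c - y)) := by
      intro n
      have hF : ∀ z, (∑ j ∈ Finset.range n, (-1 : ℂ) ^ j * (b' j : ℂ) * iteratedDeriv (2 * j) f' z) =
          (c⁻¹ : ℝ) • (fun y => ∑ j ∈ Finset.range n, (-1 : ℂ) ^ j * (b j : ℂ) * iteratedDeriv (2 * j) f y) (c⁻¹ * z) :=
        fun z => sum_rescale hf hcpos b n z
      simp_rw [hF]
      rw [show (∫ z, ((c⁻¹ : ℝ) • ∑ j ∈ Finset.range n, (-1 : ℂ) ^ j * (b j : ℂ) * iteratedDeriv (2 * j) f (c⁻¹ * z)) * φ (x - z)) =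
          ∫ y, (∑ j ∈ Finset.range n, (-1 : ℂ) ^ j * (b j : ℂ) * iteratedDeriv (2 * j) f y) * φ (x - c * y) from
        integral_rescale_mul (fun y => ∑ j ∈ Finset.range n, (-1 : ℂ) ^ j * (b j : ℂ) * iteratedDeriv (2 * j) f y) φ hcpos x]
      refine integral_congr_ae (Eventually.of_forall fun y => ?_)
      simp only [mul_sub, hxc]
    have e3 : (∫ z, h' z * φ (x - z)) = ∫ y, h y * φ (c * (x / c - y)) := by
      rw [show (fun z => h' z * φ (x - z)) = fun z => ((c⁻¹ : ℝ) • h (c⁻¹ * z)) * φ (x - z) from rfl,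
        integral_rescale_mul h φ hcpos x]
      refine integral_congr_ae (Eventually.of_forall fun y => ?_)
      simp only [mul_sub, hxc]
    rw [hxc] at key
    rw [e3]
    exact key.congr (fun n => (e1 n).symm)


/-! ## §3 The factorization identity for smooth functions with bounded derivatives -/

section Bounded

variable {b : ℕ → ℝ} {f h : ℝ → ℂ}

/-- `φ^{(m)}` is smooth when `φ` is. [folklore] -/
private theorem contDiff_iteratedDeriv_of_contDiff_top {φ : ℝ → ℂ} (hφ : ContDiff ℝ ∞ φ) (m : ℕ) :
    ContDiff ℝ ∞ (iteratedDeriv m φ) := by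
  rw [iteratedDeriv_eq_iterate]; exact hφ.iterate_deriv m

/-- `φ^{(m)}` has compact support when `φ` has. [folklore] -/
private theorem hasCompactSupport_iteratedDeriv_of_hasCompactSupport {φ : ℝ → ℂ} (hφc : HasCompactSupport φ) (m : ℕ) :
    HasCompactSupport (iteratedDeriv m φ) := by
  induction m with
  | zero => simpa using hφc
  | succ m ih => rw [iteratedDeriv_succ]; exact ih.deriv

/-- Derivatives are local: two smooth functions that agree near `t` have the same iterated derivatives at `t`. [folklore] -/
private theorem iteratedDeriv_congr_of_eventuallyEq {u v : ℝ → ℂ} {t : ℝ} (huv : u =ᶠ[𝓝 t] v) (m : ℕ) :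
    iteratedDeriv m u t = iteratedDeriv m v t := by
  rw [iteratedDeriv_eq_iteratedFDeriv, iteratedDeriv_eq_iteratedFDeriv, (huv.iteratedFDeriv ℝ m).eq_of_nhds]

/-- **THE IDENTITY FOR SMOOTH `u` WITH BOUNDED DERIVATIVES.**  Let `(b, f, h)` be a kernel package (`f, h ∈ C_c^∞(ℝ)` and
`Σ_{j<n} (−1)^j b_j f^{(2j)} ∗ φ → φ + h ∗ φ` pointwise for every `φ ∈ C_c^∞(ℝ)`), and let `u : ℝ → ℂ` be smooth with
`‖u^{(m)}‖_∞ ≤ K_m` and `Σ_j b_j K_{2j} < ∞`.  Then for every `x`,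
`u(x) = ∫ f(y) U(x − y) dy − ∫ h(y) u(x − y) dy`, `U = Σ_j (−1)^j b_j u^{(2j)}` — the one-parameter form
`φ = μ_f ∗ (Σ α_n X^n φ) + μ_g ∗ φ` of the printed proof (there `u(t) = φ(x·exp(tX))`, smooth with bounded derivatives, not
compactly supported).  Proof: cut `u` off to `ũ = χu ∈ C_c^∞` with `χ = 1` near `x − supp f ∪ x − supp h`, apply the package to
`ũ` at `x`, move the derivatives onto `ũ` (★ `integral_iteratedDeriv_mul_eq`), replace `ũ` by `u` under the integrals, and pass to
the limit by dominated convergence (`|f|·Σ_j b_j K_{2j}`).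
[cite: DixmierMalliavin1978, §3 proof of Thm. 3.1 (the one-parameter step)] [cite: Hegde2021, §3.3 proof of Thm. 18] -/
theorem eq_integral_sub_integral_of_bounded_iteratedDeriv
    (hf : ContDiff ℝ ∞ f) (hfc : HasCompactSupport f) (hhc : HasCompactSupport h)
    (hlim : ∀ φ : ℝ → ℂ, ContDiff ℝ ∞ φ → HasCompactSupport φ → ∀ x : ℝ,
        Tendsto (fun n => ∫ y, (∑ j ∈ Finset.range n,
            (-1 : ℂ) ^ j * b j * iteratedDeriv (2 * j) f y) * φ (x - y))
          atTop (𝓝 (φ x + ∫ y, h y * φ (x - y))))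
    (hb : ∀ j, 0 ≤ b j) {u : ℝ → ℂ} (hu : ContDiff ℝ ∞ u) {K : ℕ → ℝ} (hK : ∀ m x, ‖iteratedDeriv m u x‖ ≤ K m)
    (hsum : Summable fun j => b j * K (2 * j)) (x : ℝ) :
    u x = (∫ y, f y * ∑' j, (-1 : ℂ) ^ j * b j * iteratedDeriv (2 * j) u (x - y)) - ∫ y, h y * u (x - y) := by
  -- a common support radius
  obtain ⟨R, hRpos, hfR, hhR⟩ := exists_radius hfc hhc
  -- the cut-off `χ = 1` on `closedBall x (R + 1)`, `= 0` off `ball x (R + 2)`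
  let β : ContDiffBump x := ⟨R + 1, R + 2, by linarith, by linarith⟩
  set χ : ℝ → ℂ := fun t => ((β t : ℝ) : ℂ) with hχ_def
  have hχs : ContDiff ℝ ∞ χ := Complex.ofRealCLM.contDiff.comp β.contDiff
  have hχ1 : ∀ t, |t - x| ≤ R + 1 → χ t = 1 := fun t ht => by
    have : β t = 1 := β.one_of_mem_closedBall (by rw [Metric.mem_closedBall, Real.dist_eq]; exact ht)
    simp [hχ_def, this]
  -- the cut-off function `ũ = χ u ∈ C_c^∞`
  set v : ℝ → ℂ := fun t => χ t * u t with hv_def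
  have hvs : ContDiff ℝ ∞ v := hχs.mul hu
  have hvc : HasCompactSupport v :=
    (β.hasCompactSupport.comp_left Complex.ofReal_zero).mul_right
  -- `ũ = u` near every point of `closedBall x R`
  have hvu : ∀ t, |t - x| ≤ R → v =ᶠ[𝓝 t] u := by
    intro t ht
    have hopen : IsOpen (Metric.ball x (R + 1)) := Metric.isOpen_ball
    have htmem : t ∈ Metric.ball x (R + 1) := by
      rw [Metric.mem_ball, Real.dist_eq]; linarith
    filter_upwards [hopen.mem_nhds htmem] with s hs
    rw [Metric.mem_ball, Real.dist_eq] at hs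
    show χ s * u s = u s
    rw [hχ1 s hs.le, one_mul]
  have hvu_pt : ∀ y, |y| ≤ R → ∀ m, iteratedDeriv m v (x - y) = iteratedDeriv m u (x - y) := by
    intro y hy m
    refine iteratedDeriv_congr_of_eventuallyEq (hvu (x - y) ?_) m
    rw [show x - y - x = -y by ring, abs_neg]; exact hy
  have hvu_val : ∀ y, |y| ≤ R → v (x - y) = u (x - y) := fun y hy => by
    simpa using hvu_pt y hy 0
  -- the package applied to `ũ` at `x`
  have key := hlim v hvs hvc x
  have hvx : v x = u x := by simpa using hvu_val 0 (by rw [abs_zero]; exact hRpos.le)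
  have e_h : (∫ y, h y * v (x - y)) = ∫ y, h y * u (x - y) := by
    refine integral_congr_ae (Eventually.of_forall fun y => ?_)
    by_cases hy : y ∈ tsupport h
    · simp only [hvu_val y (hhR y hy)]
    · simp only [image_eq_zero_of_notMem_tsupport hy, zero_mul]
  -- move the derivatives onto `ũ`, then replace `ũ` by `u`
  set S : ℕ → ℝ → ℂ := fun n y => ∑ j ∈ Finset.range n, (-1 : ℂ) ^ j * b j * iteratedDeriv (2 * j) u (x - y) with hS_def
  have e_f : ∀ n : ℕ, (∫ y, (∑ j ∈ Finset.range n, (-1 : ℂ) ^ j * b j * iteratedDeriv (2 * j) f y) * v (x - y)) =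
      ∫ y, f y * S n y := by
    intro n
    have hint : ∀ j, Integrable fun y => (-1 : ℂ) ^ j * b j * iteratedDeriv (2 * j) f y * v (x - y) := by
      intro j
      have hc1 : Continuous fun y => iteratedDeriv (2 * j) f y := (contDiff_iteratedDeriv_of_contDiff_top hf _).continuous
      have hc2 : Continuous fun y => v (x - y) := hvs.continuous.comp (continuous_const.sub continuous_id)
      exact ((continuous_const.mul hc1).mul hc2).integrable_of_hasCompactSupport
        (((hasCompactSupport_iteratedDeriv_of_hasCompactSupport hfc (2 * j)).mul_left).mul_right)
    have hlhs : (∫ y, (∑ j ∈ Finset.range n, (-1 : ℂ) ^ j * b j * iteratedDeriv (2 * j) f y) * v (x - y)) =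
        ∑ j ∈ Finset.range n, ∫ y, (-1 : ℂ) ^ j * b j * iteratedDeriv (2 * j) f y * v (x - y) := by
      rw [← integral_finsetSum _ (fun j _ => hint j)]
      refine integral_congr_ae (Eventually.of_forall fun y => ?_)
      simp only [Finset.sum_mul]
    have hint' : ∀ j, Integrable fun y => f y * ((-1 : ℂ) ^ j * b j * iteratedDeriv (2 * j) u (x - y)) := by
      intro j
      have hc2 : Continuous fun y => iteratedDeriv (2 * j) u (x - y) :=
        (contDiff_iteratedDeriv_of_contDiff_top hu _).continuous.comp (continuous_const.sub continuous_id)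
      exact (hf.continuous.mul (continuous_const.mul hc2)).integrable_of_hasCompactSupport hfc.mul_right
    have hrhs : (∫ y, f y * S n y) = ∑ j ∈ Finset.range n, ∫ y, f y * ((-1 : ℂ) ^ j * b j * iteratedDeriv (2 * j) u (x - y)) := by
      rw [← integral_finsetSum _ (fun j _ => hint' j)]
      refine integral_congr_ae (Eventually.of_forall fun y => ?_)
      simp only [hS_def, Finset.mul_sum]
    rw [hlhs, hrhs]
    refine Finset.sum_congr rfl fun j _ => ?_
    -- one term: `∫ (−1)^j b_j f^{(2j)} ũ(x−·) = (−1)^j b_j ∫ f ũ^{(2j)}(x−·) = (−1)^j b_j ∫ f u^{(2j)}(x−·)`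
    have hvj : ContDiff ℝ ∞ (fun y => v (x - y)) := hvs.comp (contDiff_const.sub contDiff_id)
    have ibp := integral_iteratedDeriv_mul_eq hf hfc hvj (2 * j)
    have hder : ∀ y, iteratedDeriv (2 * j) (fun y => v (x - y)) y = iteratedDeriv (2 * j) v (x - y) := by
      intro y
      have := congrFun (iteratedDeriv_comp_const_sub' v x (2 * j)) y
      rw [this, pow_mul, neg_one_sq, one_pow, one_mul]
    calc ∫ y, (-1 : ℂ) ^ j * b j * iteratedDeriv (2 * j) f y * v (x - y)
        = (-1 : ℂ) ^ j * b j * ∫ y, iteratedDeriv (2 * j) f y * v (x - y) := by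
          rw [← integral_const_mul]
          refine integral_congr_ae (Eventually.of_forall fun y => ?_)
          ring
      _ = (-1 : ℂ) ^ j * b j * ∫ y, f y * iteratedDeriv (2 * j) u (x - y) := by
          rw [ibp, pow_mul, neg_one_sq, one_pow, one_mul]
          congr 1
          refine integral_congr_ae (Eventually.of_forall fun y => ?_)
          show f y * iteratedDeriv (2 * j) (fun y => v (x - y)) y = f y * iteratedDeriv (2 * j) u (x - y)
          rw [hder y]
          by_cases hy : y ∈ tsupport f
          · rw [hvu_pt y (hfR y hy)]
          · simp only [image_eq_zero_of_notMem_tsupport hy, zero_mul]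
      _ = ∫ y, f y * ((-1 : ℂ) ^ j * b j * iteratedDeriv (2 * j) u (x - y)) := by
          rw [← integral_const_mul]
          refine integral_congr_ae (Eventually.of_forall fun y => ?_)
          ring
  -- dominated convergence: `∫ f S_n → ∫ f S`
  set T : ℝ → ℂ := fun y => ∑' j, (-1 : ℂ) ^ j * b j * iteratedDeriv (2 * j) u (x - y) with hT_def
  have hK0 : ∀ m, 0 ≤ K m := fun m => (norm_nonneg _).trans (hK m 0)
  have hterm : ∀ y j, ‖(-1 : ℂ) ^ j * b j * iteratedDeriv (2 * j) u (x - y)‖ ≤ b j * K (2 * j) := by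
    intro y j
    rw [norm_mul, norm_mul, norm_pow, norm_neg, norm_one, one_pow, one_mul, Complex.norm_real, Real.norm_eq_abs,
      abs_of_nonneg (hb j)]
    exact mul_le_mul_of_nonneg_left (hK _ _) (hb j)
  have hsumy : ∀ y, Summable fun j => (-1 : ℂ) ^ j * b j * iteratedDeriv (2 * j) u (x - y) := fun y =>
    Summable.of_norm_bounded hsum (hterm y)
  set C : ℝ := ∑' j, b j * K (2 * j) with hC_def
  have hSle : ∀ n y, ‖S n y‖ ≤ C := by
    intro n y
    calc ‖S n y‖ ≤ ∑ j ∈ Finset.range n, ‖(-1 : ℂ) ^ j * b j * iteratedDeriv (2 * j) u (x - y)‖ := norm_sum_le _ _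
      _ ≤ ∑ j ∈ Finset.range n, b j * K (2 * j) := Finset.sum_le_sum fun j _ => hterm y j
      _ ≤ C := (hsum.sum_le_tsum (Finset.range n) fun j _ => mul_nonneg (hb j) (hK0 _))
  have hST : ∀ y, Tendsto (fun n => S n y) atTop (𝓝 (T y)) := fun y => (hsumy y).hasSum.tendsto_sum_nat
  have hSc : ∀ n, Continuous (S n) := by
    intro n
    refine continuous_finsetSum _ fun j _ => continuous_const.mul ?_
    exact (contDiff_iteratedDeriv_of_contDiff_top hu _).continuous.comp (continuous_const.sub continuous_id)
  have hDCT : Tendsto (fun n => ∫ y, f y * S n y) atTop (𝓝 (∫ y, f y * T y)) := by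
    refine tendsto_integral_of_dominated_convergence (fun y => ‖f y‖ * C) (fun n => ?_) ?_ (fun n => ?_) ?_
    · exact (hf.continuous.mul (hSc n)).aestronglyMeasurable
    · exact (hf.continuous.norm.integrable_of_hasCompactSupport hfc.norm).mul_const C
    · exact Eventually.of_forall fun y => by
        rw [norm_mul]
        exact mul_le_mul_of_nonneg_left (hSle n y) (norm_nonneg _)
    · exact Eventually.of_forall fun y => tendsto_const_nhds.mul (hST y)
  -- the two limits of the same sequence
  have key' : Tendsto (fun n => ∫ y, f y * S n y) atTop (𝓝 (u x + ∫ y, h y * u (x - y))) := by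
    rw [← hvx, ← e_h]
    exact key.congr (fun n => e_f n)
  have huniq := tendsto_nhds_unique key' hDCT
  exact eq_sub_of_add_eq huniq

end Bounded

end DixmierMalliavin

end Literature.Analysis.Convolution

end
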